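import Mathlib.Probability.Process.Stopping
import Mathlib.Probability.Process.LocalProperty
import Literature.Probability.Process.BrownianMotion
import Literature.Probability.RandomPlanarGeometry.LocalMartingale
import Literature.Probability.RandomPlanarGeometry.CardyFunction
import Literature.Probability.RandomPlanarGeometry.ConformalRectangle
import Literature.Probability.RandomPlanarGeometry.LoewnerChain
import Literature.Probability.RandomPlanarGeometry.SLE
import HarnessLib

-- provenance: harness21/H21/H21/Statements/CritPerc/SLEMartingale.lean @ 2a12846 (interim HEAD d8f2665); M5 mechanical rewrite
/-!
# The Cardy observable of SLE_κ is a local martingale iff `κ = 6` (family `crit-perc`, S22)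

Target statement **crit-perc.S22** of the gap inventory:

> SLE martingale characterisation behind S21: for the Loewner chain driven by `√κ B_t`, the
> process `t ↦ F(cross-ratio of g_t(z_1), …, W_t, …)` built from Cardy's `F` is a local
> martingale iff `κ = 6` (Itô computation with the hypergeometric ODE).

Sources: Lawler–Schramm–Werner, *Values of Brownian intersection exponents I*, Acta Math. 187
(2001), §§2–3; Lawler, *Conformally Invariant Processes in the Plane* (2005), Ch. 6
(locality of SLE₆ and Cardy's formula, Prop. 6.? — theorem number flagged '?' in the inventory);
Werner, *Lectures on two-dimensional critical percolation* (2007), §3.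

## Setup

Everything lives on the canonical space `(ℝ≥0 → ℝ, Literature.preWienerMeasure)` with the natural
Brownian filtration `Literature.Probability.RandomPlanarGeometry.brownianFiltration`; the driving function is `Wₜ = √κ Bₜ`
(`Literature.Probability.RandomPlanarGeometry.sleDriving`) and `gₜ` is the SLE Loewner map `Literature.Probability.RandomPlanarGeometry.sleMap` (i.e. `Literature.Probability.RandomPlanarGeometry.Loewner.map` of the
driving function). The boundary marks are `x : Fin 3 → ℝ` with `StrictMono x` and `0 < x 0`, so
that `W₀ = 0 < x₀ < x₁ < x₂` is the marked boundary 4-tuple `(a, b, c, d)` of the conformal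
rectangle `(ℍₒ; 0, x₀, x₁, x₂)`. Real points `x ≠ W₀` genuinely flow under the Loewner equation
until they are swallowed (`Literature.Probability.RandomPlanarGeometry.Loewner.IsSolution` only excludes the singularity), so
`t ↦ gₜ(xᵢ)` and hence the observable are non-constant random processes.

Cardy's **cross-ratio process** is `ηₜ = crossRatio (Wₜ, gₜ(x₀), gₜ(x₁), gₜ(x₂))`
(`Literature.Probability.RandomPlanarGeometry.cardyCrossRatio`), and the **Cardy observable** is `F(ηₜ)` with
`F = Literature.cardyFunction`: by conformal invariance and the domain Markov property it is the
conditional crossing probability `(ab) ↔ (cd)` of the conformal rectangle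
`(ℍₒ \ Kₜ; γ(t), b, c, d) ≅ (ℍₒ; Wₜ, gₜ(b), gₜ(c), gₜ(d))`. This is meaningful on the random time
interval `[0, T)`, where `T` (`Literature.Probability.RandomPlanarGeometry.swallowingStoppingTime`, an `𝓕ᵂ`-stopping time) is the
first swallowing time of a mark, i.e. the swallowing time of `x₀`. At and after `T` the
observable is *defined* as its left limit `F(η_{T-})` (which exists a.s.: on `[0, T)` the process
is a bounded semimartingale, `ηₜ ∈ (0, 1)`; when the tip hits `(x₀, x₁)`, resp. `(x₁, x₂)`, first
the limit is the crossing indicator `F(0) = 0`, resp. `F(1) = 1`). With this convention the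
process stopped at `T` is, for `κ = 6`, the genuine bounded continuous martingale of
Lawler–Schramm–Werner; freezing instead the raw formula at time `T` would pick up the junk value
of `Loewner.map` after swallowing (a jump with non-zero conditional mean) and falsify S22.

## Design notes

* Mathlib has `MeasureTheory.stoppedProcess` (with `WithTop ι`-valued times),
  `MeasureTheory.IsStoppingTime`, `ProbabilityTheory.Locally`, `MeasureTheory.Martingale`,
  `MeasureTheory.StronglyAdapted`, `MeasureTheory.Filtration.natural` and `Filter.limUnder`; all
  are used (partly through `Literature.Probability.RandomPlanarGeometry.IsLocalMartingale` and `Literature.Probability.RandomPlanarGeometry.brownianFiltration`), none is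
  redefined. Mathlib has no Loewner chains, SLE, Cardy function or cross-ratio of four real
  points (grep: `Loewner`, `crossRatio`, `Cardy`, `swallow` absent); these come from the H21
  prelude.
* Following the architect's decision D7 the statement is decoupled from Itô calculus: "local
  martingale" is `Literature.Probability.RandomPlanarGeometry.IsLocalMartingale` (Mathlib's `Locally` of `Martingale`), and the Itô
  computation `dF(ηₜ) = (…)(κ - 6) dt + (…) dBₜ` with the hypergeometric ODE
  `η(1-η)F'' + (2/3)(1-2η)F' = 0` is the *proof*, not the statement.
* The value of `cardyObservable` on `[T, ∞)` is the left limit at `T` (`Filter.limUnder` along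
  `𝓝[<] T`); when that limit does not exist `limUnder` returns an unspecified junk real (a null
  event). For `κ ≤ 4` one has `T = ⊤` a.s. and the `else` branch is a.s. never reached. Since the
  observable is already constant on `[T, ∞)`, `stoppedProcess _ (swallowingStoppingTime κ x)` in
  S22 does not change it; it is kept to display the localisation explicitly, as in print.
* Declarations are in `namespace Literature.CritPerc` (family statements namespace, as in the other
  `H21/Statements/CritPerc` files). This file does not import `Literature.Statements.CritPerc.Wave0`,
  so `cardyFunction` unambiguously denotes the prelude's `Literature.Probability.RandomPlanarGeometry.cardyFunction`.
* The inventory text has generic marks `z₁, …`; the configuration `W₀ = 0 < x₀ < x₁ < x₂` (tip =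
  first mark of the rectangle) is the representative one: any other placement of the tip among
  the four marks reduces to it by the reflection symmetry `B ↦ -B` of SLE and cyclic
  relabelling of the rectangle (`crossRatio_rev`, `crossRatio_neg`).
-/

open MeasureTheory ProbabilityTheory Filter Topology
open scoped NNReal

namespace Literature.Probability.RandomPlanarGeometry

section CritPerc

/-! ### The swallowing time of the marks -/

section Swallowing

variable (κ : ℝ≥0) (x : Fin 3 → ℝ)

/-- The **swallowing stopping time** of the marks `x`: the first time one of the marks `xᵢ` is
swallowed by the SLE_κ hull, `T(ω) = minᵢ T_{xᵢ}(ω) ∈ [0, ∞]`, where `T_z` is the Loewner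
swallowing time `Loewner.swallowingTime` of the driving function `√κ B(ω)`. For
`0 < x₀ < x₁ < x₂` this is the swallowing time of `x₀` (`swallowingStoppingTime_eq`).
Lawler (2005), Ch. 4 §4.1 (`T_x`) and Ch. 6; Lawler–Schramm–Werner, Acta Math. 187 (2001), §3. [cite: Lawler2005] -/
noncomputable def swallowingStoppingTime (ω : ℝ≥0 → ℝ) : WithTop ℝ≥0 :=
  ⨅ i, Loewner.swallowingTime (sleDriving κ ω) (x i)

/-- The swallowing stopping time is bounded by the swallowing time of each mark (by definition
of the infimum). Lawler (2005), Ch. 4 §4.1. [cite: Lawler2005] -/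
theorem swallowingStoppingTime_le_swallowingTime (ω : ℝ≥0 → ℝ) (i : Fin 3) :
    swallowingStoppingTime κ x ω ≤ Loewner.swallowingTime (sleDriving κ ω) (x i) :=
  iInf_le _ i

variable {κ x}

/-- For positive increasing marks `0 < x₀ < x₁ < x₂` the first swallowing time of a mark is the
swallowing time of the mark `x₀` closest to the tip: real points to the right of the driving
function are swallowed in increasing order (the real Loewner flow preserves the order
`Wₜ < gₜ(y) < gₜ(x)` for `W₀ < y < x` as long as `y` is not swallowed, so `T_y ≤ T_x`).
Lawler (2005), Ch. 4 §4.1 and Lemma 4.? ; Lawler–Schramm–Werner, Acta Math. 187 (2001), §3. [cite: Lawler2005] -/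
def swallowingStoppingTime_eq : Prop :=
  ∀ (hx : StrictMono x) (hx0 : 0 < x 0) (ω : ℝ≥0 → ℝ),
    swallowingStoppingTime κ x ω = Loewner.swallowingTime (sleDriving κ ω) (x 0)

/-- For positive marks the swallowing stopping time is positive for every sample path: each
`xᵢ ≠ 0 = W₀` flows for a positive time (the fact `Loewner.swallowingTime_pos`, taken as the
hypothesis `hpos`; paths of `sleDriving` are continuous). Only `Monotone x` is used; `StrictMono`
is kept for uniformity with S22. Lawler (2005), Ch. 4 §4.1. [cite: Lawler2005] -/
theorem swallowingStoppingTime_pos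
    (hpos : ∀ {W : ℝ≥0 → ℝ} {z : ℂ}, Loewner.swallowingTime_pos (W := W) (z := z))
    (hx : StrictMono x) (hx0 : 0 < x 0) (ω : ℝ≥0 → ℝ) :
    0 < swallowingStoppingTime κ x ω := by
  obtain ⟨i, hi⟩ := exists_eq_ciInf_of_finite
    (f := fun i ↦ Loewner.swallowingTime (sleDriving κ ω) (x i))
  rw [swallowingStoppingTime, ← hi]
  refine hpos (continuous_sleDriving κ ω) ?_
  have h : (0 : ℝ) < x i := hx0.trans_le (hx.monotone (Fin.zero_le i))
  rw [sleDriving_zero]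
  exact_mod_cast h.ne'

variable (κ x)

/-- The first swallowing time of the marks is a **stopping time** for the Brownian filtration
`𝓕ᵂ`: whether `x` has been swallowed by time `t` is determined by the driving path
`(√κ B_s)_{s ≤ t}`. Lawler (2005), Ch. 4 §4.1 and Ch. 6; Revuz–Yor (1999), Ch. I §4. [cite: Lawler2005] -/
def isStoppingTime_swallowingStoppingTime : Prop :=
  IsStoppingTime brownianFiltration (swallowingStoppingTime κ x)

end Swallowing

/-! ### The Cardy observable of the SLE_κ Loewner flow -/

section Observable

variable (κ : ℝ≥0) (x : Fin 3 → ℝ)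

/-- **Cardy's cross-ratio process** of SLE_κ with boundary marks `x₀ < x₁ < x₂`: at time `t` and
sample point `ω`, `ηₜ(ω) = crossRatio (Wₜ, gₜ(x₀), gₜ(x₁), gₜ(x₂))`, the cross-ratio of the tip
image `Wₜ = √κ Bₜ(ω)` and the (real) images of the marks under the SLE Loewner map
`gₜ = sleMap κ ω t`. Meaningful (and valued in `(0, 1)`) for `t` before the swallowing time of
`x₀`; afterwards `sleMap` returns junk values and so does this raw formula (see
`cardyObservable` for the regularised observable).
Lawler–Schramm–Werner, Acta Math. 187 (2001), §3; Lawler (2005), Ch. 6; Werner (2007), §3. [cite: Lawler2005] -/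
noncomputable def cardyCrossRatio (t : ℝ≥0) (ω : ℝ≥0 → ℝ) : ℝ :=
  crossRatio ![sleDriving κ ω t, (sleMap κ ω t (x 0)).re, (sleMap κ ω t (x 1)).re,
    (sleMap κ ω t (x 2)).re]

/-- The **Cardy observable** of SLE_κ with boundary marks `x₀ < x₁ < x₂`: for `t < T(ω)`
(`T = swallowingStoppingTime κ x`, the swallowing time of `x₀`) it is `F(ηₜ)` where
`F = cardyFunction` is Cardy's function and `ηₜ = cardyCrossRatio κ x t ω`; informally the
Cardy–Smirnov crossing probability `(ab) ↔ (cd)` of the conformal rectangle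
`(ℍₒ; Wₜ, gₜ(x₀), gₜ(x₁), gₜ(x₂)) ≅ (ℍₒ \ Kₜ; γ(t), x₀, x₁, x₂)`. For `t ≥ T(ω)` it is the left
limit `lim_{s ↑ T} F(η_s)` (a.s. it exists; it is the crossing indicator `0`, resp. `1`, when the
tip first hits `(x₀, x₁)`, resp. `(x₁, x₂)`); junk (unspecified `Filter.limUnder` value) on the
null event where the left limit does not exist. The `else` branch is never reached when
`T(ω) = ⊤`. Lawler–Schramm–Werner, Acta Math. 187 (2001), §3; Lawler (2005), Ch. 6;
Werner (2007), §3. [cite: Lawler2005] -/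
noncomputable def cardyObservable (t : ℝ≥0) (ω : ℝ≥0 → ℝ) : ℝ :=
  if (t : WithTop ℝ≥0) < swallowingStoppingTime κ x ω then cardyFunction (cardyCrossRatio κ x t ω)
  else limUnder (𝓝[<] (swallowingStoppingTime κ x ω).untopA)
    fun s ↦ cardyFunction (cardyCrossRatio κ x s ω)

variable {κ x}

/-- Before the swallowing time the Cardy observable is `F(ηₜ)` (by definition;
Lawler (2005), Ch. 6). [cite: Lawler2005] -/
theorem cardyObservable_of_lt {t : ℝ≥0} {ω : ℝ≥0 → ℝ}
    (ht : (t : WithTop ℝ≥0) < swallowingStoppingTime κ x ω) :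
    cardyObservable κ x t ω = cardyFunction (cardyCrossRatio κ x t ω) :=
  if_pos ht

/-- At and after the swallowing time the Cardy observable is the left limit of `s ↦ F(η_s)` at
`T` (by definition; Lawler (2005), Ch. 6; Lawler–Schramm–Werner (2001), §3). [cite: Lawler2005] -/
theorem cardyObservable_of_le {t : ℝ≥0} {ω : ℝ≥0 → ℝ}
    (ht : swallowingStoppingTime κ x ω ≤ t) :
    cardyObservable κ x t ω = limUnder (𝓝[<] (swallowingStoppingTime κ x ω).untopA)
      fun s ↦ cardyFunction (cardyCrossRatio κ x s ω) :=
  if_neg (not_lt.2 ht)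

/-- Before the swallowing time of `x₀` the flowed 4-tuple stays strictly increasing,
`Wₜ < gₜ(x₀) < gₜ(x₁) < gₜ(x₂)`, so Cardy's cross-ratio lies in `(0, 1)`
(`crossRatio_mem_Ioo`). Lawler (2005), Ch. 4 §4.1; Werner (2007), §3. [cite: Lawler2005] -/
def cardyCrossRatio_mem_Ioo : Prop :=
  ∀ (hx : StrictMono x) (hx0 : 0 < x 0) {t : ℝ≥0} {ω : ℝ≥0 → ℝ} (ht : (t : WithTop ℝ≥0) < swallowingStoppingTime κ x ω),
    cardyCrossRatio κ x t ω ∈ Set.Ioo 0 1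

/-- The stopped Cardy observable coincides with the Cardy observable: the latter is already
constant on `[T, ∞)` (by definition). Lawler (2005), Ch. 6. [cite: Lawler2005] -/
theorem stoppedProcess_cardyObservable :
    stoppedProcess (cardyObservable κ x) (swallowingStoppingTime κ x) = cardyObservable κ x := by
  ext t ω
  simp only [stoppedProcess]
  by_cases ht : (t : WithTop ℝ≥0) < swallowingStoppingTime κ x ω
  · rw [min_eq_left ht.le, WithTop.untopA, WithTop.untopD_coe]
  · rw [min_eq_right (not_lt.1 ht)]
    have hT : swallowingStoppingTime κ x ω ≠ ⊤ := ne_top_of_le_ne_top WithTop.coe_ne_top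
      (not_lt.1 ht)
    rw [cardyObservable_of_le (not_lt.1 ht), cardyObservable_of_le]
    rw [WithTop.untopA_eq_untop hT, WithTop.coe_untop]

variable (κ x)

/-- The Cardy observable is (strongly) adapted to the Brownian filtration: `gₜ(xᵢ)`, `Wₜ`, the
event `{t < T}` and the left limit at `T ≤ t` are functionals of the driving path up to time
`t`. Lawler (2005), Ch. 4 §4.1 and Ch. 6. [cite: Lawler2005] -/
def stronglyAdapted_cardyObservable : Prop :=
  StronglyAdapted brownianFiltration (cardyObservable κ x)

end Observable

/-! ### crit-perc.S22: the local martingale characterisation of `κ = 6` -/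

/-- **crit-perc.S22** (Lawler–Schramm–Werner, Acta Math. 187 (2001), §§2–3; Lawler,
*Conformally Invariant Processes in the Plane* (2005), Ch. 6, Prop. 6.?; Werner (2007), §3).
For `κ > 0` and boundary marks `0 = W₀ < x₀ < x₁ < x₂`, the Cardy observable
`t ↦ F(ηₜ)`, `ηₜ = crossRatio (Wₜ, gₜ(x₀), gₜ(x₁), gₜ(x₂))`, of the SLE_κ Loewner flow `gₜ` driven
by `Wₜ = √κ Bₜ`, stopped at the swallowing time `T` of `x₀` (with value the left limit
`F(η_{T-})`, the crossing indicator, from time `T` on), is a local martingale with respect to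
the Brownian filtration under the (pre-)Wiener measure **if and only if `κ = 6`**; for `κ = 6`
it is then a bounded continuous martingale, `F(ηₜ) ∈ [0, 1]`.
The proof in print is an Itô computation on `[0, T)`: the drift of `F(ηₜ)` is a positive
multiple of `(κ/2) η(1-η)F''(η) + (drift of η)·F'(η)`, which by the hypergeometric equation
`η(1-η)F'' + (2/3)(1-2η)F' = 0` satisfied by Cardy's function vanishes identically iff `κ = 6`;
that computation is the proof, not part of this statement (architect's decision D7: no Itô
integral is needed to *state* S22). The general configuration of the inventory (tip at any of
the four marks, marks on either side) reduces to this one by the reflection symmetry of SLE and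
relabelling of the rectangle, so the hypotheses are a normalisation, not a restriction. This is
the SLE-side input to Smirnov's identification of the percolation exploration path with SLE₆
(crit-perc.S21). [cite: Werner2007] -/
def isLocalMartingale_stoppedProcess_cardyObservable_iff : Prop :=
  ∀ {κ : ℝ≥0} (hκ : 0 < κ) {x : Fin 3 → ℝ} (hx : StrictMono x) (hx0 : 0 < x 0),
    IsLocalMartingale (stoppedProcess (cardyObservable κ x) (swallowingStoppingTime κ x))
      brownianFiltration Process.preWienerMeasure ↔ κ = 6

end CritPerc

end Literature.Probability.RandomPlanarGeometry
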